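/-
Copyright (c) 2026 the pub-hodgecm-mathlib formalisation cell (harness21).  Prover seat hodgecm-mathlib-LH4-p09 (g5): Track A «(D-RAM) FOUR-FRAME» squad of crux H413, unit U2H (ii-H),
ROW (2) census leaf (ρ2b′-X) — payer LH4-p14 (g4) socket (C) brick **(C2) «H-SIDE CLOSED FORM»**, file (C2-i): the H-side count `#Fix_{γ₂}(U₂ ⧸ K₂) + d % 2` as a closed form in
TORUS-FORM tokens of the descent, 2026-09-04.
-/
import Summits.HodgeConjecture.HodgeConjecture.Theorems.F0P3cDyRamHProfilesTypeOneAffineWild   -- ★ p856067 (LH4-p12 (g0)): §1 `mod_two_eq_zero_of_antiFixed_of_v_eq_one` ∕ `mod_two_eq_one_of_antiFixed_of_v_eq_exp_neg_one` (place type = parity of `d`), §3 `natCard_residueField_integer_eq_card_valuedResidueField` (`q_v = #𝓀_w`); brings `IsRamifiedQuadraticDatum`, ★ `isSpecialLattice_latt_of_valuation_det`, ★ anti-fixed dichotomy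
import Literature.NumberTheory.Automorphic.SLTwoTreeFixedSubtreeCount                        -- ★ (LH4-p13 (g0)): √π edge counts `pred_card_mul_ncard_fixedEdges_succ_add_two_of_{inert,eisenstein}_torusForm`; brings ★ p855331 (√π `K₂` ↔ edges), ★ p855177 (√u `K₂` ↔ vertices), ★ p855257 vertex balls in torus form
import HarnessLib

/-!
# F0 · P3c · line LH4 «(D-RAM) FOUR-FRAME» — unit (ii-H), leaf (ρ2b′-X), socket (C) brick (C2-i): THE H-SIDE COUNT `#Fix_{γ₂}(U₂(L⁺_v) ⧸ K₂) + d % 2` IS THE NUMBER OF FIXED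
# VERTICES OF THE DESCENT ON THE TREE OF `SL₂(L⁺_v)`, IN CLOSED FORM: `(q − 1)·(#Fix + d % 2) + 2 = (q + 1)·qⁿ` (inert eigen-order) ∕ `= 2·q^{n+1}` (Eisenstein eigen-order)
# (Kottwitz 1988 §2; Labesse–Langlands 1979 §2 p. 8; Tits 1979 §3.2; Rogawski 1990 §4.9)

Cell `pub/hodgecm-mathlib` (D-0151), crux H413 = `stmt-HodgeConjecture-24833` (helper lane `--supports stmt-HodgeConjecture-24833 --as helper`, count-neutral); THEOREMS ONLY (no
definition, no instance, no notation, no named fact, no `sorry`, default heartbeats).  Tree socket served: (ρ2b′-X) `stub_U2H_fixedPointCensus_typeTwo_unit0` of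
`Cruxes/H413/Lines/F0_P3c_DyRamFourFrame_U2H_HSide.lean` (ED. 15 :418), through the payer lineage's organ interface ★ p857374 `latticeCensus_literals_of_signedCensusNV (hOrgNV)`, whose
H-SIDE CLAUSE is `#Fix_{γ₂}(U₂ ⧸ K₂) + d % 2 = N_V` (ℕ) with the SAME `N_V` as the G-side clause `(q − 1)·(N t_h − N t_a) = ε·q^m·((q − 1)·N_V − 2·(q^{d − d%2} − 1))` — payer
LH4-p14 (g4) socket (C) split 2026-09-04T05:05:59Z, brick **(C2)** dealt to this seat; MAP v1 seam S8.  This file is (C2-i): the ℕ-law of `N_V := #Fix + d % 2` in the torus-form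
tokens of a descent representative; (C2-ii) (the torus datum of the descent of a TYPE-(2) element at a wild place, from the eigen-package ★ p857432) and (C2-iii) (the level letter
`2n = j_λ` ∕ `2n = j_λ − d` ∕ RM, heir LEAD T19-05 (1)) are separate files of this seat.

WHAT IS PROVED.  Let `w ∣ v` be a ramified non-split place of the CM field `L` (`he`), `α ∈ L_w` ANTI-FIXED (`σ_w α = −α`), `γ₂ ∈ U₂ = U(Φ₂)(L⁺_v)` ARBITRARY, `(s, g)` a descent
representative of `E₂γ₂` (`diag(1, α)·E₂γ₂·diag(1, α)⁻¹ = s·ι_w(g)`, `g ∈ GL₂(L⁺_v)` — ★ `exists_conj_diagonal_eq_smul_map_toPlace`), and suppose `g` is conjugate UP TO A SCALAR to a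
unit of a quadratic order in torus form: `h g h⁻¹ = c·γ₁`, `γ₁ = (a, b·v; b, a + b·u)`, `a b ∈ 𝒪_v`, `|det γ₁|_v = 1`, `c ≠ 0`, `|b|_v = |ϖ_v|ⁿ`, where the datum `(u, v)` (`τ² = uτ + v`)
is either INERT (`hanis`: the norm form `c² + ceu − e²v` is anisotropic modulo `𝔭_v` — the eigen-field `L⁺_v(τ)` of `g` is the unramified quadratic extension) or EISENSTEIN
(`|u|_v < 1`, `|v|_v = |ϖ_v|` — the eigen-field is a ramified quadratic extension of `L⁺_v` OTHER than `L_w`).  Write `q = #𝓀(𝒪[L⁺_v])` (`= #𝓀_w`, §3) and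
`#Fix := Nat.card (fixedBy (U₂ ⧸ K₂) γ₂)`, `K₂ = cmLocalIntegralLevel L 2 Φ₂ v = U(Φ₂)(𝒪_v)`.
* §1 √u-TYPE PLACE (`|α|_w = 1`; then `K₂` is the stabiliser of the ROOT VERTEX, ★ p855177 `natCard_fixedBy_cmLocalIntegralLevel_eq_ncard_setOf_glVertexAct_of_v_eq_one`):
  **`(q − 1)·#Fix + 2 = (q + 1)·qⁿ`** (inert) ∕ **`= 2·q^{n+1}`** (Eisenstein) — ★ p855257 `ncard_setOf_glVertexAct_eq_self_of_{inert,eisenstein}_torusForm`.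
* §2 √π-TYPE PLACE (`|α|_w = |ϖ_w|`; then `K₂` is the set-wise stabiliser of the ROOT EDGE, ★ p855331 `natCard_fixedBy_cmLocalIntegralLevel_eq_ncard_fixedEdges_of_v_eq_exp_neg_one`):
  **`(q − 1)·(#Fix + 1) + 2 = (q + 1)·qⁿ`** ∕ **`= 2·q^{n+1}`** — ★ `pred_card_mul_ncard_fixedEdges_succ_add_two_of_{inert,eisenstein}_torusForm` (a regular elliptic `g` fixes a
  finite subtree; edges = vertices − 1).
* §3 THE PARITY SELECTOR (the currency of ★ p857374's H-side clause): for the ramified quadratic datum of record `IsRamifiedQuadraticDatum σ_w ϖ d t_E` the place type IS the parity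
  of `d` (★ p856067 §1: an anti-fixed unit forces `d` even, an anti-fixed uniformiser forces `d` odd), so in EITHER place type **`(q − 1)·(#Fix + d % 2) + 2 = (q + 1)·qⁿ`** (inert) ∕
  **`= 2·q^{n+1}`** (Eisenstein) — four heads `pred_card_mul_natCard_fixedBy_add_mod_two_add_two_of_v_eq_{one,exp_neg_one}_of_{inert,eisenstein}`; and the same with
  `q = Fintype.card 𝓀_w` (★ p856067 §3), the letter of ★ p857374 — `…_card_valuedResidueField_…`.
The root vertex `latt 1` of the tree is supplied inside the proofs (★ `isSpecialLattice_latt_of_valuation_det`), so the heads carry NO vertex binder.  These are LH4-p13 (g0)'s ★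
p855511 `F0P3cDyRamHSideTypeTwoTorusForm` heads WITHOUT the orbital-integral unfolding (no measure, no `IsLocalGRegular`, no type hypothesis on `γ₂`), `K₂` column only, plus the
parity selector: exactly what the lattice-currency interface consumes.  Any residue characteristic (no `|2|_w = 1`).

WHAT IS NOT CLAIMED.  The EXISTENCE of the torus datum `(u, v; h, c, a, b, n)` for the descent of a given type-(2) `γ₂` at a wild place ((C2-ii), from the eigen-package ★ p857432
and ★ `SLTwoTreeQuadraticTorusNormalForm`), and the LEVEL LETTER tying `n` to the conductor level `j_λ` of the eigenvalue in the line model ((C2-iii); heir LEAD T19-05 (1): class U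
`2n = j_λ`, class RK `2n = j_λ − d`) are separate files; nothing printed is asserted.  HONEST LABEL: HC_CM is proved only modulo the 7 printed citations (2 remaining named inputs:
hLiu418 = stmt-HodgeConjecture-24832, h413 = stmt-HodgeConjecture-24833) until rung 0 closes; (ρ2b′-X) stays OPEN; count-neutral.

## References
* [Kottwitz1988] R. E. Kottwitz, *Tamagawa numbers*, Ann. of Math. 127 (1988), §2 (orbital integrals of indicators as fixed-coset counts; the fixed subtree of an elliptic element).
* [LabesseLanglands1979] J.-P. Labesse, R. P. Langlands, *L-indistinguishability for SL(2)*, Canad. J. Math. 31 (1979), §2 p. 8 (fixed balls of elliptic tori: `1 + (q+1)(qⁿ − 1)∕(q − 1)`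
  vertices for an inert, `2(q^{n+1} − 1)∕(q − 1)` for a ramified eigen-order of conductor `n`).
* [Tits1979] J. Tits, *Reductive groups over local fields*, PSPM 33.1 (1979), §2.7 p. 48, §3.2 p. 50 (quasi-split `U(1,1)`: the building is the tree of `SL₂`; vertex and edge stabilisers).
* [Rogawski1990] J. D. Rogawski, *Automorphic Representations of Unitary Groups in Three Variables*, Ann. of Math. Stud. 123 (1990), §4.9 Prop. 4.9.1 (b) p. 55, Lemma 4.9.3 p. 56
  (the `H`-side terms of the fundamental lemma near `1`).
* [Serre1980Trees] J.-P. Serre, *Trees* (1980), Ch. I §6.1, Ch. II §1.1–§1.3 (the tree of `SL₂` over a local field).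
* [Jacobowitz1962] R. Jacobowitz, *Hermitian forms over local fields*, Amer. J. Math. 84 (1962), §5, §9 (ramified dyadic: parity of the different exponent, R-U ∕ R-P).
-/

set_option autoImplicit false

noncomputable section

namespace Summit.HodgeConjecture.HodgeConjecture.Cruxes.H413.F0P3cDyRamHSideFixedCountTorusForm

open NumberField IsDedekindDomain MulAction Matrix WithZero ValuativeRel
open Literature.NumberTheory.Automorphic Literature.NumberTheory.Automorphic.UnitaryGroup
open Literature.NumberTheory.Automorphic.UnitaryThreeFourFrame
open Literature.NumberTheory.Automorphic.HermitianLatticeTree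
open Summit.HodgeConjecture.HodgeConjecture.Cruxes.H413.F0P3cDyRamHProfilesTypeOneAffineWild
  (mod_two_eq_zero_of_antiFixed_of_v_eq_one mod_two_eq_one_of_antiFixed_of_v_eq_exp_neg_one natCard_residueField_integer_eq_card_valuedResidueField)
open scoped Matrix MatrixGroups ValuativeRel WithZero

section Place

variable (L : Type) [Field L] [NumberField L] [IsCMField L] (v : HeightOneSpectrum (𝓞 ↥(maximalRealSubfield L)))
  (w : PlacesOver L v) (hw : IsCMField.complexConj L • w.1 = w.1)
  {α : w.1.adicCompletion L} (hα : galAdicCompletionMap (L := L) (IsCMField.complexConj L) hw α = -α) (hα0 : α ≠ 0)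
  {ϖF : v.adicCompletion ↥(maximalRealSubfield L)} (hϖF : Valued.v ϖF = exp (-1 : ℤ))
  [Finite (IsLocalRing.ResidueField 𝒪[v.adicCompletion ↥(maximalRealSubfield L)])]

omit [IsCMField L] [Finite (IsLocalRing.ResidueField 𝒪[v.adicCompletion ↥(maximalRealSubfield L)])] in
include hϖF in
/-- The root vertex `latt 1` of the tree of `SL₂(L⁺_v)` is a special lattice (★ `isSpecialLattice_latt_of_valuation_det` at `e = 0`). [cite: Serre1980Trees, Ch. II §1.1] -/
theorem isSpecialLattice_latt_one :
    IsSpecialLattice (RingHom.id (v.adicCompletion ↥(maximalRealSubfield L))) ϖF !![(0 : v.adicCompletion ↥(maximalRealSubfield L)), 1; -1, 0]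
      (latt (1 : Matrix (Fin 2) (Fin 2) (v.adicCompletion ↥(maximalRealSubfield L)))) := by
  have h0 : ϖF ≠ 0 := fun h => by rw [h, map_zero] at hϖF; exact WithZero.zero_ne_coe hϖF
  have h1 := isSpecialLattice_latt_of_valuation_det h0 (1 : GL (Fin 2) (v.adicCompletion ↥(maximalRealSubfield L))) (e := 0) (Or.inl rfl)
    (by rw [Units.val_one, Matrix.det_one, zpow_zero])
  rwa [Units.val_one] at h1

/-! ## §1 √u-TYPE PLACES (`α` an anti-fixed UNIT; `d` even): `K₂` ↔ fixed VERTICES -/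

include hw hα hα0 hϖF in
/-- **H-SIDE COUNT, √u-TYPE PLACE, INERT EIGEN-ORDER: `(q − 1)·#Fix_{γ₂}(U₂ ⧸ K₂) + 2 = (q + 1)·qⁿ`** — `γ₂ ∈ U₂` arbitrary, `(s, g)` a descent representative of `E₂γ₂`, `g` conjugate up to a
scalar to a unit `(a, bv; b, a + bu)` (`|b| = |ϖ_v|ⁿ`) of the INERT order `𝒪_v[τ]`, `τ² = uτ + v`.  ★ p855177 (`K₂` ↔ fixed vertices at a √u place) + ★ p855257 (vertex ball).  Any residue characteristic.
[cite: Kottwitz1988, §2] [cite: LabesseLanglands1979, §2 p. 8] [cite: Tits1979, §3.2 p. 50] [cite: Rogawski1990, §4.9 Prop. 4.9.1 (b) p. 55] -/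
theorem pred_card_mul_natCard_fixedBy_add_two_of_v_eq_one_of_inert (he : v.asIdeal.ramificationIdx' w.1.asIdeal ≠ 1) (hvα : Valued.v α = 1)
    (γ₂ : ((cmDatum L 2 (Matrix.of fun i j : Fin 2 => if i.val + j.val + 1 = 2 then (1 : L) else 0)).Local v))
    -- the descent representative `g ∈ GL₂(L⁺_v)` of `E₂ γ₂` (★ `exists_conj_diagonal_eq_smul_map_toPlace`)
    {s : w.1.adicCompletion L} {g : GL (Fin 2) (v.adicCompletion ↥(maximalRealSubfield L))} (hs : s ≠ 0)
    (hsg : Matrix.diagonal ![1, α] * ((((localNonsplitEquiv (IsCMField.complexConj L) (Matrix.of fun i j : Fin 2 => if i.val + j.val + 1 = 2 then (1 : L) else 0) (IsCMField.complexConj_ne_one L) w hw) γ₂ : ↥(unitaryGroupOfForm (galAdicCompletionMap (L := L) (IsCMField.complexConj L) hw) (placeForm (Matrix.of fun i j : Fin 2 => if i.val + j.val + 1 = 2 then (1 : L) else 0) w.1))) : GL (Fin 2) (w.1.adicCompletion L)) : Matrix (Fin 2) (Fin 2) (w.1.adicCompletion L)) * Matrix.diagonal ![1, α⁻¹] =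
      s • (g : Matrix (Fin 2) (Fin 2) (v.adicCompletion ↥(maximalRealSubfield L))).map (toPlace v w))
    -- the INERT torus datum of `g`
    {uτ vτ : v.adicCompletion ↥(maximalRealSubfield L)} (hu : uτ ∈ 𝒪[v.adicCompletion ↥(maximalRealSubfield L)]) (hv : vτ ∈ 𝒪[v.adicCompletion ↥(maximalRealSubfield L)])
    (hanis : ∀ c e : v.adicCompletion ↥(maximalRealSubfield L), c ∈ 𝒪[v.adicCompletion ↥(maximalRealSubfield L)] → e ∈ 𝒪[v.adicCompletion ↥(maximalRealSubfield L)] → valuation (v.adicCompletion ↥(maximalRealSubfield L)) (c ^ 2 + c * e * uτ - e ^ 2 * vτ) < 1 → valuation (v.adicCompletion ↥(maximalRealSubfield L)) c < 1 ∧ valuation (v.adicCompletion ↥(maximalRealSubfield L)) e < 1)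
    {h γ₁ : GL (Fin 2) (v.adicCompletion ↥(maximalRealSubfield L))} {c a b : v.adicCompletion ↥(maximalRealSubfield L)} (hc : c ≠ 0)
    (hconj : ((h * g * h⁻¹ : GL (Fin 2) (v.adicCompletion ↥(maximalRealSubfield L))) : Matrix (Fin 2) (Fin 2) (v.adicCompletion ↥(maximalRealSubfield L))) = c • (γ₁ : Matrix (Fin 2) (Fin 2) (v.adicCompletion ↥(maximalRealSubfield L))))
    (hγ₁ : (γ₁ : Matrix (Fin 2) (Fin 2) (v.adicCompletion ↥(maximalRealSubfield L))) = !![a, b * vτ; b, a + b * uτ]) (ha : a ∈ 𝒪[v.adicCompletion ↥(maximalRealSubfield L)]) (hb : b ∈ 𝒪[v.adicCompletion ↥(maximalRealSubfield L)])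
    (hγ₁det : valuation (v.adicCompletion ↥(maximalRealSubfield L)) (γ₁ : Matrix (Fin 2) (Fin 2) (v.adicCompletion ↥(maximalRealSubfield L))).det = 1) {n : ℕ} (hbn : valuation (v.adicCompletion ↥(maximalRealSubfield L)) b = valuation (v.adicCompletion ↥(maximalRealSubfield L)) ϖF ^ n) :
    (Nat.card (IsLocalRing.ResidueField 𝒪[v.adicCompletion ↥(maximalRealSubfield L)]) - 1) *
        Nat.card (fixedBy (((cmDatum L 2 (Matrix.of fun i j : Fin 2 => if i.val + j.val + 1 = 2 then (1 : L) else 0)).Local v) ⧸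
          cmLocalIntegralLevel L 2 (Matrix.of fun i j : Fin 2 => if i.val + j.val + 1 = 2 then (1 : L) else 0) v) γ₂) + 2 =
      (Nat.card (IsLocalRing.ResidueField 𝒪[v.adicCompletion ↥(maximalRealSubfield L)]) + 1) * Nat.card (IsLocalRing.ResidueField 𝒪[v.adicCompletion ↥(maximalRealSubfield L)]) ^ n := by
  haveI : IsDiscreteValuationRing 𝒪[v.adicCompletion ↥(maximalRealSubfield L)] := isDiscreteValuationRing_integer_of_compatible hϖF
  rw [natCard_fixedBy_cmLocalIntegralLevel_eq_ncard_setOf_glVertexAct_of_v_eq_one L v w hw hα hα0 hϖF he hvα γ₂ hs hsg]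
  exact ncard_setOf_glVertexAct_eq_self_of_inert_torusForm (isUniformizingElement_of_v_eq hϖF) hu hv hanis hc hconj hγ₁ ha hb hγ₁det hbn
    ⟨_, isSpecialLattice_latt_one L v hϖF⟩ rfl

include hw hα hα0 hϖF in
/-- **H-SIDE COUNT, √u-TYPE PLACE, EISENSTEIN EIGEN-ORDER: `(q − 1)·#Fix_{γ₂}(U₂ ⧸ K₂) + 2 = 2·q^{n+1}`** — as above with an EISENSTEIN datum (`|u| < 1`, `|v| = |ϖ_v|`: the eigen-field of
`g` is a ramified quadratic extension of `L⁺_v` other than `L_w`).  ★ p855177 + ★ p855257. [cite: Kottwitz1988, §2] [cite: LabesseLanglands1979, §2 p. 8] [cite: Tits1979, §3.2 p. 50] [cite: Rogawski1990, §4.9 Prop. 4.9.1 (b) p. 55] -/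
theorem pred_card_mul_natCard_fixedBy_add_two_of_v_eq_one_of_eisenstein (he : v.asIdeal.ramificationIdx' w.1.asIdeal ≠ 1) (hvα : Valued.v α = 1)
    (γ₂ : ((cmDatum L 2 (Matrix.of fun i j : Fin 2 => if i.val + j.val + 1 = 2 then (1 : L) else 0)).Local v))
    {s : w.1.adicCompletion L} {g : GL (Fin 2) (v.adicCompletion ↥(maximalRealSubfield L))} (hs : s ≠ 0)
    (hsg : Matrix.diagonal ![1, α] * ((((localNonsplitEquiv (IsCMField.complexConj L) (Matrix.of fun i j : Fin 2 => if i.val + j.val + 1 = 2 then (1 : L) else 0) (IsCMField.complexConj_ne_one L) w hw) γ₂ : ↥(unitaryGroupOfForm (galAdicCompletionMap (L := L) (IsCMField.complexConj L) hw) (placeForm (Matrix.of fun i j : Fin 2 => if i.val + j.val + 1 = 2 then (1 : L) else 0) w.1))) : GL (Fin 2) (w.1.adicCompletion L)) : Matrix (Fin 2) (Fin 2) (w.1.adicCompletion L)) * Matrix.diagonal ![1, α⁻¹] =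
      s • (g : Matrix (Fin 2) (Fin 2) (v.adicCompletion ↥(maximalRealSubfield L))).map (toPlace v w))
    -- the EISENSTEIN torus datum of `g`
    {uτ vτ : v.adicCompletion ↥(maximalRealSubfield L)} (hu : uτ ∈ 𝒪[v.adicCompletion ↥(maximalRealSubfield L)]) (hu1 : valuation (v.adicCompletion ↥(maximalRealSubfield L)) uτ < 1) (hv1 : valuation (v.adicCompletion ↥(maximalRealSubfield L)) vτ = valuation (v.adicCompletion ↥(maximalRealSubfield L)) ϖF)
    {h γ₁ : GL (Fin 2) (v.adicCompletion ↥(maximalRealSubfield L))} {c a b : v.adicCompletion ↥(maximalRealSubfield L)} (hc : c ≠ 0)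
    (hconj : ((h * g * h⁻¹ : GL (Fin 2) (v.adicCompletion ↥(maximalRealSubfield L))) : Matrix (Fin 2) (Fin 2) (v.adicCompletion ↥(maximalRealSubfield L))) = c • (γ₁ : Matrix (Fin 2) (Fin 2) (v.adicCompletion ↥(maximalRealSubfield L))))
    (hγ₁ : (γ₁ : Matrix (Fin 2) (Fin 2) (v.adicCompletion ↥(maximalRealSubfield L))) = !![a, b * vτ; b, a + b * uτ]) (ha : a ∈ 𝒪[v.adicCompletion ↥(maximalRealSubfield L)]) (hb : b ∈ 𝒪[v.adicCompletion ↥(maximalRealSubfield L)])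
    (hγ₁det : valuation (v.adicCompletion ↥(maximalRealSubfield L)) (γ₁ : Matrix (Fin 2) (Fin 2) (v.adicCompletion ↥(maximalRealSubfield L))).det = 1) {n : ℕ} (hbn : valuation (v.adicCompletion ↥(maximalRealSubfield L)) b = valuation (v.adicCompletion ↥(maximalRealSubfield L)) ϖF ^ n) :
    (Nat.card (IsLocalRing.ResidueField 𝒪[v.adicCompletion ↥(maximalRealSubfield L)]) - 1) *
        Nat.card (fixedBy (((cmDatum L 2 (Matrix.of fun i j : Fin 2 => if i.val + j.val + 1 = 2 then (1 : L) else 0)).Local v) ⧸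
          cmLocalIntegralLevel L 2 (Matrix.of fun i j : Fin 2 => if i.val + j.val + 1 = 2 then (1 : L) else 0) v) γ₂) + 2 =
      2 * Nat.card (IsLocalRing.ResidueField 𝒪[v.adicCompletion ↥(maximalRealSubfield L)]) ^ (n + 1) := by
  haveI : IsDiscreteValuationRing 𝒪[v.adicCompletion ↥(maximalRealSubfield L)] := isDiscreteValuationRing_integer_of_compatible hϖF
  rw [natCard_fixedBy_cmLocalIntegralLevel_eq_ncard_setOf_glVertexAct_of_v_eq_one L v w hw hα hα0 hϖF he hvα γ₂ hs hsg]
  exact ncard_setOf_glVertexAct_eq_self_of_eisenstein_torusForm (isUniformizingElement_of_v_eq hϖF) hu hu1 hv1 hc hconj hγ₁ ha hb hγ₁det hbn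
    ⟨_, isSpecialLattice_latt_one L v hϖF⟩ rfl

/-! ## §2 √π-TYPE PLACES (`α` an anti-fixed UNIFORMISER; `d` odd): `K₂` ↔ set-wise fixed EDGES, one fewer than the fixed vertices -/

include hw hα hα0 hϖF in
/-- **H-SIDE COUNT, √π-TYPE PLACE, INERT EIGEN-ORDER: `(q − 1)·(#Fix_{γ₂}(U₂ ⧸ K₂) + 1) + 2 = (q + 1)·qⁿ`** — at a √π place `K₂` is the set-wise stabiliser of the root EDGE (★ p855331), and
the fixed subtree of `g` has one edge fewer than vertices (★ `SLTwoTreeFixedSubtreeCount` §1–§2).  Any residue characteristic.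
[cite: Kottwitz1988, §2] [cite: LabesseLanglands1979, §2 p. 8] [cite: Tits1979, §3.2 p. 50] [cite: Serre1980Trees, Ch. I §6.1] -/
theorem pred_card_mul_natCard_fixedBy_succ_add_two_of_v_eq_exp_neg_one_of_inert (he : v.asIdeal.ramificationIdx' w.1.asIdeal ≠ 1) (hvα : Valued.v α = exp (-1 : ℤ))
    (γ₂ : ((cmDatum L 2 (Matrix.of fun i j : Fin 2 => if i.val + j.val + 1 = 2 then (1 : L) else 0)).Local v))
    {s : w.1.adicCompletion L} {g : GL (Fin 2) (v.adicCompletion ↥(maximalRealSubfield L))} (hs : s ≠ 0)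
    (hsg : Matrix.diagonal ![1, α] * ((((localNonsplitEquiv (IsCMField.complexConj L) (Matrix.of fun i j : Fin 2 => if i.val + j.val + 1 = 2 then (1 : L) else 0) (IsCMField.complexConj_ne_one L) w hw) γ₂ : ↥(unitaryGroupOfForm (galAdicCompletionMap (L := L) (IsCMField.complexConj L) hw) (placeForm (Matrix.of fun i j : Fin 2 => if i.val + j.val + 1 = 2 then (1 : L) else 0) w.1))) : GL (Fin 2) (w.1.adicCompletion L)) : Matrix (Fin 2) (Fin 2) (w.1.adicCompletion L)) * Matrix.diagonal ![1, α⁻¹] =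
      s • (g : Matrix (Fin 2) (Fin 2) (v.adicCompletion ↥(maximalRealSubfield L))).map (toPlace v w))
    {uτ vτ : v.adicCompletion ↥(maximalRealSubfield L)} (hu : uτ ∈ 𝒪[v.adicCompletion ↥(maximalRealSubfield L)]) (hv : vτ ∈ 𝒪[v.adicCompletion ↥(maximalRealSubfield L)])
    (hanis : ∀ c e : v.adicCompletion ↥(maximalRealSubfield L), c ∈ 𝒪[v.adicCompletion ↥(maximalRealSubfield L)] → e ∈ 𝒪[v.adicCompletion ↥(maximalRealSubfield L)] → valuation (v.adicCompletion ↥(maximalRealSubfield L)) (c ^ 2 + c * e * uτ - e ^ 2 * vτ) < 1 → valuation (v.adicCompletion ↥(maximalRealSubfield L)) c < 1 ∧ valuation (v.adicCompletion ↥(maximalRealSubfield L)) e < 1)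
    {h γ₁ : GL (Fin 2) (v.adicCompletion ↥(maximalRealSubfield L))} {c a b : v.adicCompletion ↥(maximalRealSubfield L)} (hc : c ≠ 0)
    (hconj : ((h * g * h⁻¹ : GL (Fin 2) (v.adicCompletion ↥(maximalRealSubfield L))) : Matrix (Fin 2) (Fin 2) (v.adicCompletion ↥(maximalRealSubfield L))) = c • (γ₁ : Matrix (Fin 2) (Fin 2) (v.adicCompletion ↥(maximalRealSubfield L))))
    (hγ₁ : (γ₁ : Matrix (Fin 2) (Fin 2) (v.adicCompletion ↥(maximalRealSubfield L))) = !![a, b * vτ; b, a + b * uτ]) (ha : a ∈ 𝒪[v.adicCompletion ↥(maximalRealSubfield L)]) (hb : b ∈ 𝒪[v.adicCompletion ↥(maximalRealSubfield L)])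
    (hγ₁det : valuation (v.adicCompletion ↥(maximalRealSubfield L)) (γ₁ : Matrix (Fin 2) (Fin 2) (v.adicCompletion ↥(maximalRealSubfield L))).det = 1) {n : ℕ} (hbn : valuation (v.adicCompletion ↥(maximalRealSubfield L)) b = valuation (v.adicCompletion ↥(maximalRealSubfield L)) ϖF ^ n) :
    (Nat.card (IsLocalRing.ResidueField 𝒪[v.adicCompletion ↥(maximalRealSubfield L)]) - 1) *
        (Nat.card (fixedBy (((cmDatum L 2 (Matrix.of fun i j : Fin 2 => if i.val + j.val + 1 = 2 then (1 : L) else 0)).Local v) ⧸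
          cmLocalIntegralLevel L 2 (Matrix.of fun i j : Fin 2 => if i.val + j.val + 1 = 2 then (1 : L) else 0) v) γ₂) + 1) + 2 =
      (Nat.card (IsLocalRing.ResidueField 𝒪[v.adicCompletion ↥(maximalRealSubfield L)]) + 1) * Nat.card (IsLocalRing.ResidueField 𝒪[v.adicCompletion ↥(maximalRealSubfield L)]) ^ n := by
  haveI : IsDiscreteValuationRing 𝒪[v.adicCompletion ↥(maximalRealSubfield L)] := isDiscreteValuationRing_integer_of_compatible hϖF
  rw [natCard_fixedBy_cmLocalIntegralLevel_eq_ncard_fixedEdges_of_v_eq_exp_neg_one L v w hw hα hα0 hϖF he hvα γ₂ hs hsg]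
  exact pred_card_mul_ncard_fixedEdges_succ_add_two_of_inert_torusForm (isUniformizingElement_of_v_eq hϖF) hu hv hanis hc hconj hγ₁ ha hb hγ₁det hbn
    ⟨_, isSpecialLattice_latt_one L v hϖF⟩ rfl

include hw hα hα0 hϖF in
/-- **H-SIDE COUNT, √π-TYPE PLACE, EISENSTEIN EIGEN-ORDER: `(q − 1)·(#Fix_{γ₂}(U₂ ⧸ K₂) + 1) + 2 = 2·q^{n+1}`** (★ p855331 + ★ `SLTwoTreeFixedSubtreeCount` §2).
[cite: Kottwitz1988, §2] [cite: LabesseLanglands1979, §2 p. 8] [cite: Tits1979, §3.2 p. 50] [cite: Serre1980Trees, Ch. I §6.1] -/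
theorem pred_card_mul_natCard_fixedBy_succ_add_two_of_v_eq_exp_neg_one_of_eisenstein (he : v.asIdeal.ramificationIdx' w.1.asIdeal ≠ 1) (hvα : Valued.v α = exp (-1 : ℤ))
    (γ₂ : ((cmDatum L 2 (Matrix.of fun i j : Fin 2 => if i.val + j.val + 1 = 2 then (1 : L) else 0)).Local v))
    {s : w.1.adicCompletion L} {g : GL (Fin 2) (v.adicCompletion ↥(maximalRealSubfield L))} (hs : s ≠ 0)
    (hsg : Matrix.diagonal ![1, α] * ((((localNonsplitEquiv (IsCMField.complexConj L) (Matrix.of fun i j : Fin 2 => if i.val + j.val + 1 = 2 then (1 : L) else 0) (IsCMField.complexConj_ne_one L) w hw) γ₂ : ↥(unitaryGroupOfForm (galAdicCompletionMap (L := L) (IsCMField.complexConj L) hw) (placeForm (Matrix.of fun i j : Fin 2 => if i.val + j.val + 1 = 2 then (1 : L) else 0) w.1))) : GL (Fin 2) (w.1.adicCompletion L)) : Matrix (Fin 2) (Fin 2) (w.1.adicCompletion L)) * Matrix.diagonal ![1, α⁻¹] =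
      s • (g : Matrix (Fin 2) (Fin 2) (v.adicCompletion ↥(maximalRealSubfield L))).map (toPlace v w))
    {uτ vτ : v.adicCompletion ↥(maximalRealSubfield L)} (hu : uτ ∈ 𝒪[v.adicCompletion ↥(maximalRealSubfield L)]) (hu1 : valuation (v.adicCompletion ↥(maximalRealSubfield L)) uτ < 1) (hv1 : valuation (v.adicCompletion ↥(maximalRealSubfield L)) vτ = valuation (v.adicCompletion ↥(maximalRealSubfield L)) ϖF)
    {h γ₁ : GL (Fin 2) (v.adicCompletion ↥(maximalRealSubfield L))} {c a b : v.adicCompletion ↥(maximalRealSubfield L)} (hc : c ≠ 0)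
    (hconj : ((h * g * h⁻¹ : GL (Fin 2) (v.adicCompletion ↥(maximalRealSubfield L))) : Matrix (Fin 2) (Fin 2) (v.adicCompletion ↥(maximalRealSubfield L))) = c • (γ₁ : Matrix (Fin 2) (Fin 2) (v.adicCompletion ↥(maximalRealSubfield L))))
    (hγ₁ : (γ₁ : Matrix (Fin 2) (Fin 2) (v.adicCompletion ↥(maximalRealSubfield L))) = !![a, b * vτ; b, a + b * uτ]) (ha : a ∈ 𝒪[v.adicCompletion ↥(maximalRealSubfield L)]) (hb : b ∈ 𝒪[v.adicCompletion ↥(maximalRealSubfield L)])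
    (hγ₁det : valuation (v.adicCompletion ↥(maximalRealSubfield L)) (γ₁ : Matrix (Fin 2) (Fin 2) (v.adicCompletion ↥(maximalRealSubfield L))).det = 1) {n : ℕ} (hbn : valuation (v.adicCompletion ↥(maximalRealSubfield L)) b = valuation (v.adicCompletion ↥(maximalRealSubfield L)) ϖF ^ n) :
    (Nat.card (IsLocalRing.ResidueField 𝒪[v.adicCompletion ↥(maximalRealSubfield L)]) - 1) *
        (Nat.card (fixedBy (((cmDatum L 2 (Matrix.of fun i j : Fin 2 => if i.val + j.val + 1 = 2 then (1 : L) else 0)).Local v) ⧸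
          cmLocalIntegralLevel L 2 (Matrix.of fun i j : Fin 2 => if i.val + j.val + 1 = 2 then (1 : L) else 0) v) γ₂) + 1) + 2 =
      2 * Nat.card (IsLocalRing.ResidueField 𝒪[v.adicCompletion ↥(maximalRealSubfield L)]) ^ (n + 1) := by
  haveI : IsDiscreteValuationRing 𝒪[v.adicCompletion ↥(maximalRealSubfield L)] := isDiscreteValuationRing_integer_of_compatible hϖF
  rw [natCard_fixedBy_cmLocalIntegralLevel_eq_ncard_fixedEdges_of_v_eq_exp_neg_one L v w hw hα hα0 hϖF he hvα γ₂ hs hsg]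
  exact pred_card_mul_ncard_fixedEdges_succ_add_two_of_eisenstein_torusForm (isUniformizingElement_of_v_eq hϖF) hu hu1 hv1 hc hconj hγ₁ ha hb hγ₁det hbn
    ⟨_, isSpecialLattice_latt_one L v hϖF⟩ rfl

/-! ## §3 THE PARITY SELECTOR: place type = parity of `d` for the datum of record, so `(q − 1)·(#Fix + d % 2) + 2 = …` in EITHER place type -/

include hw hα hα0 hϖF in
/-- **(C2-i) H-SIDE CLOSED FORM, INERT EIGEN-ORDER: `(q − 1)·(#Fix_{γ₂}(U₂ ⧸ K₂) + d % 2) + 2 = (q + 1)·qⁿ`.**  For the ramified quadratic datum of record `(σ_w, ϖ, d, t_E)`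
(`IsRamifiedQuadraticDatum`) and an anti-fixed `α` which is a unit OR a uniformiser (★ `exists_units_galAdicCompletionMap_complexConj_eq_neg_of_ramified` gives one), any `γ₂ ∈ U₂` whose
descent representative `g` is conjugate up to a scalar to a unit `(a, bv; b, a + bu)` (`|b| = |ϖ_v|ⁿ`) of an INERT order.  `|α| = 1` forces `d` even (★ p856067 §1) and §1 applies;
`|α| = |ϖ_w|` forces `d` odd and §2 applies.  `q = #𝓀(𝒪[L⁺_v])`.  This is ★ p857374's H-side clause with `N_V := #Fix + d % 2` and its inert ℕ-law.
[cite: Kottwitz1988, §2] [cite: LabesseLanglands1979, §2 p. 8] [cite: Tits1979, §3.2 p. 50] [cite: Rogawski1990, §4.9 Prop. 4.9.1 (b) p. 55, Lemma 4.9.3 p. 56] [cite: Jacobowitz1962, §5, §9] -/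
theorem pred_card_mul_natCard_fixedBy_add_mod_two_add_two_of_inert (he : v.asIdeal.ramificationIdx' w.1.asIdeal ≠ 1)
    {ϖ : w.1.adicCompletion L} {d tE : ℕ} (hD : IsRamifiedQuadraticDatum (galAdicCompletionMap (L := L) (IsCMField.complexConj L) hw) ϖ d tE)
    (hvα : Valued.v α = 1 ∨ Valued.v α = exp (-1 : ℤ))
    (γ₂ : ((cmDatum L 2 (Matrix.of fun i j : Fin 2 => if i.val + j.val + 1 = 2 then (1 : L) else 0)).Local v))
    {s : w.1.adicCompletion L} {g : GL (Fin 2) (v.adicCompletion ↥(maximalRealSubfield L))} (hs : s ≠ 0)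
    (hsg : Matrix.diagonal ![1, α] * ((((localNonsplitEquiv (IsCMField.complexConj L) (Matrix.of fun i j : Fin 2 => if i.val + j.val + 1 = 2 then (1 : L) else 0) (IsCMField.complexConj_ne_one L) w hw) γ₂ : ↥(unitaryGroupOfForm (galAdicCompletionMap (L := L) (IsCMField.complexConj L) hw) (placeForm (Matrix.of fun i j : Fin 2 => if i.val + j.val + 1 = 2 then (1 : L) else 0) w.1))) : GL (Fin 2) (w.1.adicCompletion L)) : Matrix (Fin 2) (Fin 2) (w.1.adicCompletion L)) * Matrix.diagonal ![1, α⁻¹] =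
      s • (g : Matrix (Fin 2) (Fin 2) (v.adicCompletion ↥(maximalRealSubfield L))).map (toPlace v w))
    {uτ vτ : v.adicCompletion ↥(maximalRealSubfield L)} (hu : uτ ∈ 𝒪[v.adicCompletion ↥(maximalRealSubfield L)]) (hv : vτ ∈ 𝒪[v.adicCompletion ↥(maximalRealSubfield L)])
    (hanis : ∀ c e : v.adicCompletion ↥(maximalRealSubfield L), c ∈ 𝒪[v.adicCompletion ↥(maximalRealSubfield L)] → e ∈ 𝒪[v.adicCompletion ↥(maximalRealSubfield L)] → valuation (v.adicCompletion ↥(maximalRealSubfield L)) (c ^ 2 + c * e * uτ - e ^ 2 * vτ) < 1 → valuation (v.adicCompletion ↥(maximalRealSubfield L)) c < 1 ∧ valuation (v.adicCompletion ↥(maximalRealSubfield L)) e < 1)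
    {h γ₁ : GL (Fin 2) (v.adicCompletion ↥(maximalRealSubfield L))} {c a b : v.adicCompletion ↥(maximalRealSubfield L)} (hc : c ≠ 0)
    (hconj : ((h * g * h⁻¹ : GL (Fin 2) (v.adicCompletion ↥(maximalRealSubfield L))) : Matrix (Fin 2) (Fin 2) (v.adicCompletion ↥(maximalRealSubfield L))) = c • (γ₁ : Matrix (Fin 2) (Fin 2) (v.adicCompletion ↥(maximalRealSubfield L))))
    (hγ₁ : (γ₁ : Matrix (Fin 2) (Fin 2) (v.adicCompletion ↥(maximalRealSubfield L))) = !![a, b * vτ; b, a + b * uτ]) (ha : a ∈ 𝒪[v.adicCompletion ↥(maximalRealSubfield L)]) (hb : b ∈ 𝒪[v.adicCompletion ↥(maximalRealSubfield L)])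
    (hγ₁det : valuation (v.adicCompletion ↥(maximalRealSubfield L)) (γ₁ : Matrix (Fin 2) (Fin 2) (v.adicCompletion ↥(maximalRealSubfield L))).det = 1) {n : ℕ} (hbn : valuation (v.adicCompletion ↥(maximalRealSubfield L)) b = valuation (v.adicCompletion ↥(maximalRealSubfield L)) ϖF ^ n) :
    (Nat.card (IsLocalRing.ResidueField 𝒪[v.adicCompletion ↥(maximalRealSubfield L)]) - 1) *
        (Nat.card (fixedBy (((cmDatum L 2 (Matrix.of fun i j : Fin 2 => if i.val + j.val + 1 = 2 then (1 : L) else 0)).Local v) ⧸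
          cmLocalIntegralLevel L 2 (Matrix.of fun i j : Fin 2 => if i.val + j.val + 1 = 2 then (1 : L) else 0) v) γ₂) + d % 2) + 2 =
      (Nat.card (IsLocalRing.ResidueField 𝒪[v.adicCompletion ↥(maximalRealSubfield L)]) + 1) * Nat.card (IsLocalRing.ResidueField 𝒪[v.adicCompletion ↥(maximalRealSubfield L)]) ^ n := by
  rcases hvα with hvα | hvα
  · rw [mod_two_eq_zero_of_antiFixed_of_v_eq_one hD hα hvα, add_zero]
    exact pred_card_mul_natCard_fixedBy_add_two_of_v_eq_one_of_inert L v w hw hα hα0 hϖF he hvα γ₂ hs hsg hu hv hanis hc hconj hγ₁ ha hb hγ₁det hbn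
  · rw [mod_two_eq_one_of_antiFixed_of_v_eq_exp_neg_one hD hα hvα]
    exact pred_card_mul_natCard_fixedBy_succ_add_two_of_v_eq_exp_neg_one_of_inert L v w hw hα hα0 hϖF he hvα γ₂ hs hsg hu hv hanis hc hconj hγ₁ ha hb hγ₁det hbn

include hw hα hα0 hϖF in
/-- **(C2-i) H-SIDE CLOSED FORM, EISENSTEIN EIGEN-ORDER: `(q − 1)·(#Fix_{γ₂}(U₂ ⧸ K₂) + d % 2) + 2 = 2·q^{n+1}`** — as above with an EISENSTEIN datum (`|u| < 1`, `|v| = |ϖ_v|`).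
[cite: Kottwitz1988, §2] [cite: LabesseLanglands1979, §2 p. 8] [cite: Tits1979, §3.2 p. 50] [cite: Rogawski1990, §4.9 Prop. 4.9.1 (b) p. 55, Lemma 4.9.3 p. 56] [cite: Jacobowitz1962, §5, §9] -/
theorem pred_card_mul_natCard_fixedBy_add_mod_two_add_two_of_eisenstein (he : v.asIdeal.ramificationIdx' w.1.asIdeal ≠ 1)
    {ϖ : w.1.adicCompletion L} {d tE : ℕ} (hD : IsRamifiedQuadraticDatum (galAdicCompletionMap (L := L) (IsCMField.complexConj L) hw) ϖ d tE)
    (hvα : Valued.v α = 1 ∨ Valued.v α = exp (-1 : ℤ))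
    (γ₂ : ((cmDatum L 2 (Matrix.of fun i j : Fin 2 => if i.val + j.val + 1 = 2 then (1 : L) else 0)).Local v))
    {s : w.1.adicCompletion L} {g : GL (Fin 2) (v.adicCompletion ↥(maximalRealSubfield L))} (hs : s ≠ 0)
    (hsg : Matrix.diagonal ![1, α] * ((((localNonsplitEquiv (IsCMField.complexConj L) (Matrix.of fun i j : Fin 2 => if i.val + j.val + 1 = 2 then (1 : L) else 0) (IsCMField.complexConj_ne_one L) w hw) γ₂ : ↥(unitaryGroupOfForm (galAdicCompletionMap (L := L) (IsCMField.complexConj L) hw) (placeForm (Matrix.of fun i j : Fin 2 => if i.val + j.val + 1 = 2 then (1 : L) else 0) w.1))) : GL (Fin 2) (w.1.adicCompletion L)) : Matrix (Fin 2) (Fin 2) (w.1.adicCompletion L)) * Matrix.diagonal ![1, α⁻¹] =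
      s • (g : Matrix (Fin 2) (Fin 2) (v.adicCompletion ↥(maximalRealSubfield L))).map (toPlace v w))
    {uτ vτ : v.adicCompletion ↥(maximalRealSubfield L)} (hu : uτ ∈ 𝒪[v.adicCompletion ↥(maximalRealSubfield L)]) (hu1 : valuation (v.adicCompletion ↥(maximalRealSubfield L)) uτ < 1) (hv1 : valuation (v.adicCompletion ↥(maximalRealSubfield L)) vτ = valuation (v.adicCompletion ↥(maximalRealSubfield L)) ϖF)
    {h γ₁ : GL (Fin 2) (v.adicCompletion ↥(maximalRealSubfield L))} {c a b : v.adicCompletion ↥(maximalRealSubfield L)} (hc : c ≠ 0)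
    (hconj : ((h * g * h⁻¹ : GL (Fin 2) (v.adicCompletion ↥(maximalRealSubfield L))) : Matrix (Fin 2) (Fin 2) (v.adicCompletion ↥(maximalRealSubfield L))) = c • (γ₁ : Matrix (Fin 2) (Fin 2) (v.adicCompletion ↥(maximalRealSubfield L))))
    (hγ₁ : (γ₁ : Matrix (Fin 2) (Fin 2) (v.adicCompletion ↥(maximalRealSubfield L))) = !![a, b * vτ; b, a + b * uτ]) (ha : a ∈ 𝒪[v.adicCompletion ↥(maximalRealSubfield L)]) (hb : b ∈ 𝒪[v.adicCompletion ↥(maximalRealSubfield L)])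
    (hγ₁det : valuation (v.adicCompletion ↥(maximalRealSubfield L)) (γ₁ : Matrix (Fin 2) (Fin 2) (v.adicCompletion ↥(maximalRealSubfield L))).det = 1) {n : ℕ} (hbn : valuation (v.adicCompletion ↥(maximalRealSubfield L)) b = valuation (v.adicCompletion ↥(maximalRealSubfield L)) ϖF ^ n) :
    (Nat.card (IsLocalRing.ResidueField 𝒪[v.adicCompletion ↥(maximalRealSubfield L)]) - 1) *
        (Nat.card (fixedBy (((cmDatum L 2 (Matrix.of fun i j : Fin 2 => if i.val + j.val + 1 = 2 then (1 : L) else 0)).Local v) ⧸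
          cmLocalIntegralLevel L 2 (Matrix.of fun i j : Fin 2 => if i.val + j.val + 1 = 2 then (1 : L) else 0) v) γ₂) + d % 2) + 2 =
      2 * Nat.card (IsLocalRing.ResidueField 𝒪[v.adicCompletion ↥(maximalRealSubfield L)]) ^ (n + 1) := by
  rcases hvα with hvα | hvα
  · rw [mod_two_eq_zero_of_antiFixed_of_v_eq_one hD hα hvα, add_zero]
    exact pred_card_mul_natCard_fixedBy_add_two_of_v_eq_one_of_eisenstein L v w hw hα hα0 hϖF he hvα γ₂ hs hsg hu hu1 hv1 hc hconj hγ₁ ha hb hγ₁det hbn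
  · rw [mod_two_eq_one_of_antiFixed_of_v_eq_exp_neg_one hD hα hvα]
    exact pred_card_mul_natCard_fixedBy_succ_add_two_of_v_eq_exp_neg_one_of_eisenstein L v w hw hα hα0 hϖF he hvα γ₂ hs hsg hu hu1 hv1 hc hconj hγ₁ ha hb hγ₁det hbn

/-! ## §4 The same in the letter `q = #𝓀_w` of the organ interface ★ p857374 (`Fintype.card (Valued.ResidueField L_w)`; `f(w ∣ v) = 1`, ★ p856067 §3) -/

include hw hα hα0 hϖF in
/-- **(C2-i) H-SIDE CLOSED FORM IN THE INTERFACE'S LETTERS, INERT: `(#𝓀_w − 1)·(#Fix_{γ₂}(U₂ ⧸ K₂) + d % 2) + 2 = (#𝓀_w + 1)·#𝓀_wⁿ`** (§3 + ★ `natCard_residueField_integer_eq_card_valuedResidueField`).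
[cite: Kottwitz1988, §2] [cite: LabesseLanglands1979, §2 p. 8] [cite: Rogawski1990, §4.9 Prop. 4.9.1 (b) p. 55, Lemma 4.9.3 p. 56] [cite: Serre1979, Ch. II §2] -/
theorem pred_card_valuedResidueField_mul_natCard_fixedBy_add_mod_two_add_two_of_inert (he : v.asIdeal.ramificationIdx' w.1.asIdeal ≠ 1)
    [Fintype (Valued.ResidueField (w.1.adicCompletion L))]
    {ϖ : w.1.adicCompletion L} {d tE : ℕ} (hD : IsRamifiedQuadraticDatum (galAdicCompletionMap (L := L) (IsCMField.complexConj L) hw) ϖ d tE)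
    (hvα : Valued.v α = 1 ∨ Valued.v α = exp (-1 : ℤ))
    (γ₂ : ((cmDatum L 2 (Matrix.of fun i j : Fin 2 => if i.val + j.val + 1 = 2 then (1 : L) else 0)).Local v))
    {s : w.1.adicCompletion L} {g : GL (Fin 2) (v.adicCompletion ↥(maximalRealSubfield L))} (hs : s ≠ 0)
    (hsg : Matrix.diagonal ![1, α] * ((((localNonsplitEquiv (IsCMField.complexConj L) (Matrix.of fun i j : Fin 2 => if i.val + j.val + 1 = 2 then (1 : L) else 0) (IsCMField.complexConj_ne_one L) w hw) γ₂ : ↥(unitaryGroupOfForm (galAdicCompletionMap (L := L) (IsCMField.complexConj L) hw) (placeForm (Matrix.of fun i j : Fin 2 => if i.val + j.val + 1 = 2 then (1 : L) else 0) w.1))) : GL (Fin 2) (w.1.adicCompletion L)) : Matrix (Fin 2) (Fin 2) (w.1.adicCompletion L)) * Matrix.diagonal ![1, α⁻¹] =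
      s • (g : Matrix (Fin 2) (Fin 2) (v.adicCompletion ↥(maximalRealSubfield L))).map (toPlace v w))
    {uτ vτ : v.adicCompletion ↥(maximalRealSubfield L)} (hu : uτ ∈ 𝒪[v.adicCompletion ↥(maximalRealSubfield L)]) (hv : vτ ∈ 𝒪[v.adicCompletion ↥(maximalRealSubfield L)])
    (hanis : ∀ c e : v.adicCompletion ↥(maximalRealSubfield L), c ∈ 𝒪[v.adicCompletion ↥(maximalRealSubfield L)] → e ∈ 𝒪[v.adicCompletion ↥(maximalRealSubfield L)] → valuation (v.adicCompletion ↥(maximalRealSubfield L)) (c ^ 2 + c * e * uτ - e ^ 2 * vτ) < 1 → valuation (v.adicCompletion ↥(maximalRealSubfield L)) c < 1 ∧ valuation (v.adicCompletion ↥(maximalRealSubfield L)) e < 1)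
    {h γ₁ : GL (Fin 2) (v.adicCompletion ↥(maximalRealSubfield L))} {c a b : v.adicCompletion ↥(maximalRealSubfield L)} (hc : c ≠ 0)
    (hconj : ((h * g * h⁻¹ : GL (Fin 2) (v.adicCompletion ↥(maximalRealSubfield L))) : Matrix (Fin 2) (Fin 2) (v.adicCompletion ↥(maximalRealSubfield L))) = c • (γ₁ : Matrix (Fin 2) (Fin 2) (v.adicCompletion ↥(maximalRealSubfield L))))
    (hγ₁ : (γ₁ : Matrix (Fin 2) (Fin 2) (v.adicCompletion ↥(maximalRealSubfield L))) = !![a, b * vτ; b, a + b * uτ]) (ha : a ∈ 𝒪[v.adicCompletion ↥(maximalRealSubfield L)]) (hb : b ∈ 𝒪[v.adicCompletion ↥(maximalRealSubfield L)])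
    (hγ₁det : valuation (v.adicCompletion ↥(maximalRealSubfield L)) (γ₁ : Matrix (Fin 2) (Fin 2) (v.adicCompletion ↥(maximalRealSubfield L))).det = 1) {n : ℕ} (hbn : valuation (v.adicCompletion ↥(maximalRealSubfield L)) b = valuation (v.adicCompletion ↥(maximalRealSubfield L)) ϖF ^ n) :
    (Fintype.card (Valued.ResidueField (w.1.adicCompletion L)) - 1) *
        (Nat.card (fixedBy (((cmDatum L 2 (Matrix.of fun i j : Fin 2 => if i.val + j.val + 1 = 2 then (1 : L) else 0)).Local v) ⧸
          cmLocalIntegralLevel L 2 (Matrix.of fun i j : Fin 2 => if i.val + j.val + 1 = 2 then (1 : L) else 0) v) γ₂) + d % 2) + 2 =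
      (Fintype.card (Valued.ResidueField (w.1.adicCompletion L)) + 1) * Fintype.card (Valued.ResidueField (w.1.adicCompletion L)) ^ n := by
  rw [← natCard_residueField_integer_eq_card_valuedResidueField L w hw he]
  exact pred_card_mul_natCard_fixedBy_add_mod_two_add_two_of_inert L v w hw hα hα0 hϖF he hD hvα γ₂ hs hsg hu hv hanis hc hconj hγ₁ ha hb hγ₁det hbn

include hw hα hα0 hϖF in
/-- **(C2-i) H-SIDE CLOSED FORM IN THE INTERFACE'S LETTERS, EISENSTEIN: `(#𝓀_w − 1)·(#Fix_{γ₂}(U₂ ⧸ K₂) + d % 2) + 2 = 2·#𝓀_w^{n+1}`** (§3 + ★ `natCard_residueField_integer_eq_card_valuedResidueField`).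
[cite: Kottwitz1988, §2] [cite: LabesseLanglands1979, §2 p. 8] [cite: Rogawski1990, §4.9 Prop. 4.9.1 (b) p. 55, Lemma 4.9.3 p. 56] [cite: Serre1979, Ch. II §2] -/
theorem pred_card_valuedResidueField_mul_natCard_fixedBy_add_mod_two_add_two_of_eisenstein (he : v.asIdeal.ramificationIdx' w.1.asIdeal ≠ 1)
    [Fintype (Valued.ResidueField (w.1.adicCompletion L))]
    {ϖ : w.1.adicCompletion L} {d tE : ℕ} (hD : IsRamifiedQuadraticDatum (galAdicCompletionMap (L := L) (IsCMField.complexConj L) hw) ϖ d tE)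
    (hvα : Valued.v α = 1 ∨ Valued.v α = exp (-1 : ℤ))
    (γ₂ : ((cmDatum L 2 (Matrix.of fun i j : Fin 2 => if i.val + j.val + 1 = 2 then (1 : L) else 0)).Local v))
    {s : w.1.adicCompletion L} {g : GL (Fin 2) (v.adicCompletion ↥(maximalRealSubfield L))} (hs : s ≠ 0)
    (hsg : Matrix.diagonal ![1, α] * ((((localNonsplitEquiv (IsCMField.complexConj L) (Matrix.of fun i j : Fin 2 => if i.val + j.val + 1 = 2 then (1 : L) else 0) (IsCMField.complexConj_ne_one L) w hw) γ₂ : ↥(unitaryGroupOfForm (galAdicCompletionMap (L := L) (IsCMField.complexConj L) hw) (placeForm (Matrix.of fun i j : Fin 2 => if i.val + j.val + 1 = 2 then (1 : L) else 0) w.1))) : GL (Fin 2) (w.1.adicCompletion L)) : Matrix (Fin 2) (Fin 2) (w.1.adicCompletion L)) * Matrix.diagonal ![1, α⁻¹] =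
      s • (g : Matrix (Fin 2) (Fin 2) (v.adicCompletion ↥(maximalRealSubfield L))).map (toPlace v w))
    {uτ vτ : v.adicCompletion ↥(maximalRealSubfield L)} (hu : uτ ∈ 𝒪[v.adicCompletion ↥(maximalRealSubfield L)]) (hu1 : valuation (v.adicCompletion ↥(maximalRealSubfield L)) uτ < 1) (hv1 : valuation (v.adicCompletion ↥(maximalRealSubfield L)) vτ = valuation (v.adicCompletion ↥(maximalRealSubfield L)) ϖF)
    {h γ₁ : GL (Fin 2) (v.adicCompletion ↥(maximalRealSubfield L))} {c a b : v.adicCompletion ↥(maximalRealSubfield L)} (hc : c ≠ 0)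
    (hconj : ((h * g * h⁻¹ : GL (Fin 2) (v.adicCompletion ↥(maximalRealSubfield L))) : Matrix (Fin 2) (Fin 2) (v.adicCompletion ↥(maximalRealSubfield L))) = c • (γ₁ : Matrix (Fin 2) (Fin 2) (v.adicCompletion ↥(maximalRealSubfield L))))
    (hγ₁ : (γ₁ : Matrix (Fin 2) (Fin 2) (v.adicCompletion ↥(maximalRealSubfield L))) = !![a, b * vτ; b, a + b * uτ]) (ha : a ∈ 𝒪[v.adicCompletion ↥(maximalRealSubfield L)]) (hb : b ∈ 𝒪[v.adicCompletion ↥(maximalRealSubfield L)])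
    (hγ₁det : valuation (v.adicCompletion ↥(maximalRealSubfield L)) (γ₁ : Matrix (Fin 2) (Fin 2) (v.adicCompletion ↥(maximalRealSubfield L))).det = 1) {n : ℕ} (hbn : valuation (v.adicCompletion ↥(maximalRealSubfield L)) b = valuation (v.adicCompletion ↥(maximalRealSubfield L)) ϖF ^ n) :
    (Fintype.card (Valued.ResidueField (w.1.adicCompletion L)) - 1) *
        (Nat.card (fixedBy (((cmDatum L 2 (Matrix.of fun i j : Fin 2 => if i.val + j.val + 1 = 2 then (1 : L) else 0)).Local v) ⧸
          cmLocalIntegralLevel L 2 (Matrix.of fun i j : Fin 2 => if i.val + j.val + 1 = 2 then (1 : L) else 0) v) γ₂) + d % 2) + 2 =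
      2 * Fintype.card (Valued.ResidueField (w.1.adicCompletion L)) ^ (n + 1) := by
  rw [← natCard_residueField_integer_eq_card_valuedResidueField L w hw he]
  exact pred_card_mul_natCard_fixedBy_add_mod_two_add_two_of_eisenstein L v w hw hα hα0 hϖF he hD hvα γ₂ hs hsg hu hu1 hv1 hc hconj hγ₁ ha hb hγ₁det hbn

end Place

end Summit.HodgeConjecture.HodgeConjecture.Cruxes.H413.F0P3cDyRamHSideFixedCountTorusForm

end
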